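import Summits.QuantumFields.QCD.Theorems.PauliWegnerSeaFMClosureUnquenchedSideWitnessC1Aux7
import Summits.QuantumFields.QCD.Theorems.PauliWegnerSeaFMClosureUnquenchedSideWitnessC1Aux8

/-!
# Side witness, part 9: the side witness on the complement of an even box

Crux `FMClosureUnquenched` (stmt-QuantumFields-11512), line `von-mises-circles`, registered sub-goal
`c1_sideWitness : SideWitness`.

The complement `(ebox S x r)ᶜ` of the even box is the complement of the corner box `[0, 2r+2)⁴`
(corner `x + (-r-1, …, -r-1)`, Aux6); its deficit sites have coordinates `2, 3` in the even range
`[0, 2r+2)`, so the `2 × 2` tiles in the plane `(2, 3)` (Aux7) serve as supplementary system for the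
complement flow of Aux8.  Result: `sideWitness_ebox_compl` (= registered `c1_sideWitness_aux9`).
-/

namespace Summit.QuantumFields.QCD.Theorems.VonMisesCirclesC1

open Matrix Literature.MathematicalPhysics.QuantumLattice Literature.Probability.LatticeModels
open Summit.QuantumFields.QCD.Theorems.VonMisesCircles Literature.MathematicalPhysics.QuantumFieldTheory

set_option quotPrecheck false in
set_option hygiene false in
/-- The unit step `±e_μ` of label `ℓ = (μ, b)` on the torus of side `2S+1` (`STP`, to keep the
generic-`N` name `STEP` of parts 3–5 free). -/
local notation "STP" ℓ:arg =>
  (if Prod.snd ℓ then -(Pi.single (Prod.fst ℓ) 1 : TorusSite 4 (2 * S + 1)) else Pi.single (Prod.fst ℓ) 1)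

set_option quotPrecheck false in
set_option hygiene false in
/-- Offset coordinate `i` of the site `y` from the corner `c`, in `{0, …, 2S}`. -/
local notation "OFF" c:arg y:arg i:arg => (ZMod.val ((y : TorusSite 4 (2 * S + 1)) i - (c : TorusSite 4 (2 * S + 1)) i))

set_option quotPrecheck false in
/-- Out-label of the `2 × 2`-tile 4-cycle in the plane `(i, j)` at offsets of parities `(u, v)`. -/
local notation "TL" i:arg j:arg u:arg v:arg =>
  (if u % 2 = 0 then (if v % 2 = 0 then ((i, false) : Fin 4 × Bool) else ((j, true) : Fin 4 × Bool))
    else (if v % 2 = 0 then ((j, false) : Fin 4 × Bool) else ((i, true) : Fin 4 × Bool)))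

set_option quotPrecheck false in
/-- In-label of the `2 × 2`-tile 4-cycle in the plane `(i, j)` at offsets of parities `(u, v)`. -/
local notation "EL" i:arg j:arg u:arg v:arg =>
  (if u % 2 = 0 then (if v % 2 = 0 then ((j, true) : Fin 4 × Bool) else ((i, true) : Fin 4 × Bool))
    else (if v % 2 = 0 then ((i, false) : Fin 4 × Bool) else ((j, false) : Fin 4 × Bool)))

set_option quotPrecheck false in
/-- The reversed label. -/
local notation "REV" ℓ:arg => ((Prod.fst ℓ, !(Prod.snd ℓ)) : Fin 4 × Bool)

/-- The complement of the even box as the complement of a corner box. -/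
theorem ebox_compl_eq_filter (S : ℕ) (x : TorusSite 4 (2 * S + 1)) {r : ℕ} (hr : r + 1 ≤ S) :
    (ebox S x r)ᶜ = Finset.univ.filter (fun y : TorusSite 4 (2 * S + 1) =>
      ∃ i : Fin 4, 2 * r + 2 ≤ OFF (x + Torus.proj (2 * S + 1) (fun _ => -(r : ℤ) - 1)) y i) := by
  ext y
  rw [Finset.mem_compl, mem_ebox_iff x hr y, Finset.mem_filter]
  simp only [Finset.mem_univ, true_and, not_forall, not_lt]

/-- **Side witness on the complement of an even box** (registered `c1_sideWitness_aux9`). -/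
theorem sideWitness_ebox_compl (S : ℕ) (x : TorusSite 4 (2 * S + 1)) (r : ℕ) (hr : r + 1 ≤ S) (m₀ : ℝ) :
    ∃ U : GaugeConfig 4 (2 * S + 1) (Matrix.specialUnitaryGroup (Fin 3) ℂ),
      (sideMatrix (ebox S x r)ᶜ (wilsonD U m₀)).det ≠ 0 := by
  rw [ebox_compl_eq_filter S x hr]
  set c : TorusSite 4 (2 * S + 1) := x + Torus.proj (2 * S + 1) (fun _ => -(r : ℤ) - 1) with hc
  have hn2 : (2 * r + 2) % 2 = 0 := by omega
  have hnS : 2 * r + 2 ≤ 2 * S := by omega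
  have h23 : (2 : Fin 4) ≠ 3 := by decide
  -- the tile system in the plane `(2, 3)` at a deficit site
  have T := fun (y : TorusSite 4 (2 * S + 1)) (h2 : OFF c y 2 < 2 * r + 2) (h3 : OFF c y 3 < 2 * r + 2) =>
    tile_flow c hn2 hnS h23 y rfl rfl h2 h3
  refine compl_flow_sideWitness c (2 * r + 2) m₀
    (fun y => TL 2 3 (OFF c y 2) (OFF c y 3)) (fun y => EL 2 3 (OFF c y 2) (OFF c y 3))
    (fun y => TL 2 3 (OFF c y 2) (OFF c y 3)) (fun y => EL 2 3 (OFF c y 2) (OFF c y 3)) ?_ ?_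
  · intro y h0 h1 h2 h3
    obtain ⟨⟨hz2, hz3, hzk⟩, hz, ⟨hp2, hp3, hpk⟩, hp, hd, he, hne⟩ := T y h2 h3
    refine ⟨⟨⟨0, ?_⟩, ?_, hz2, hz3, hz⟩, ⟨⟨0, ?_⟩, ?_, hp2, hp3, hp⟩, ?_, ?_, ?_⟩
    · rw [hzk 0 (by decide) (by decide)]; exact h0
    · rw [hzk 1 (by decide) (by decide)]; exact h1
    · rw [hpk 0 (by decide) (by decide)]; exact h0
    · rw [hpk 1 (by decide) (by decide)]; exact h1
    · rcases hd with h | h <;> rw [h] <;> decide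
    · rcases he with h | h <;> rw [h] <;> decide
    · intro h
      have h' := congrArg Prod.fst h
      exact hne h'
  · intro y h1 h0 h2 h3
    obtain ⟨⟨hz2, hz3, hzk⟩, hz, ⟨hp2, hp3, hpk⟩, hp, hd, he, hne⟩ := T y h2 h3
    refine ⟨⟨⟨1, ?_⟩, ?_, hz2, hz3, hz⟩, ⟨⟨1, ?_⟩, ?_, hp2, hp3, hp⟩, ?_, ?_, ?_⟩
    · rw [hzk 1 (by decide) (by decide)]; exact h1
    · rw [hzk 0 (by decide) (by decide)]; exact h0
    · rw [hpk 1 (by decide) (by decide)]; exact h1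
    · rw [hpk 0 (by decide) (by decide)]; exact h0
    · rcases hd with h | h <;> rw [h] <;> decide
    · rcases he with h | h <;> rw [h] <;> decide
    · intro h
      have h' := congrArg Prod.fst h
      exact hne h'

/-- **Registered helper `c1_sideWitness_aux9` of crux stmt-QuantumFields-11512** (line `von-mises-circles`,
sub-goal `c1_sideWitness`): the side witness on the complement of an even box. -/
theorem c1_sideWitness_aux9 : ∀ (S : ℕ) (x : TorusSite 4 (2 * S + 1)) (r : ℕ), r + 1 ≤ S → ∀ (m₀ : ℝ), ∃ U : GaugeConfig 4 (2 * S + 1) (Matrix.specialUnitaryGroup (Fin 3) ℂ), (sideMatrix (ebox S x r)ᶜ (wilsonD U m₀)).det ≠ 0 :=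
  fun S x r hr m₀ => sideWitness_ebox_compl S x r hr m₀

end Summit.QuantumFields.QCD.Theorems.VonMisesCirclesC1
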